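import Summits.HodgeConjecture.CorCM.IrreducibleOddWeightsEvaluation
import HarnessLib

/-!
# Evaluation spaces on a transitive slot by Frobenius reciprocity: `Ev_w(π) = A_w · V^H` (`Hom_G(ℚ^X, V) ≅ V^H`)

COR-CM (cell `pub-hodgecm2`, binder seat `b16` gen 57, count-neutral claim MULTIPLICITY, file F5 — sequel of F1
`CorCM/IrreducibleOddWeightsEvaluation` (local notation `Ev[G, π, w] = {T w : T : ℚ^X → V equivariant}`, orbit span
`𝒪[G, w]`); theorems only, no definition, no named fact, no `sorry`).  NEW as stated, hence under
`Summits/`.  HONEST FRAMING: makes the multiplicity formula for the rank of (families of) CM types COMPUTABLE from a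
Galois model — `dim Hg(∏_i A_i)` for CM abelian varieties `A_i` with CM by ANY CM fields `K_i` (every
`Hom(K_i, ℂ)` is a transitive `Aut(ℂ)`-set with stabiliser `H_i = Aut(ℂ/x_i K_i)`) as a sum over irreducible
`ℚ`-representations of ranks of explicit operators on `H_i`-invariants; "rank for NAMED configurations" (kernel,
unconditional) for INT-4 «what is known»; `HC_CM` is neither used nor asserted.

FROBENIUS RECIPROCITY, CONCRETELY.  `X` a `G`-set with a point `x₀`, `H = Stab(x₀)`, and a SECTION `s : X → G`,
`s(x)·x₀ = x` (exists iff `X` is transitive).  For a representation `(π, V)`: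
* §1 `comp_smul_single` (`g · δ_{x₀} = δ_{g x₀}`), `apply_single_smul_eq` (an equivariant `T : ℚ^X → V` has
  `T(δ_{g x₀}) = π(g) T(δ_{x₀})`), `apply_single_mem_invariants` (`T(δ_{x₀}) ∈ V^H`), `apply_eq_sum_smul`
  (`T(w) = Σ_x w(x) π(s x) T(δ_{x₀})`); conversely `equivariant_sum_smul` (for `v ∈ V^H`,
  `T_v(f) = Σ_x f(x) π(s x) v` is equivariant with `T_v(δ_{x₀}) = v`) — i.e. `Hom_G(ℚ^X, V) ≅ V^H`;
* §2 **`evalSpace_eq_map_invariants`**: `Ev[G, π, w] = A_w(V^H)`, the image of the `H`-invariants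
  `V^H = (π|_H).invariants` under the operator `A_w = Σ_x w(x) π(s x)` (for `X = G`, `H = 1`: the column space of
  Mai's matrix `π(w) = Σ_g w(g) π(g)`, `evalSpace_eq_range_of_regular`);
The multiplicity formulas on transitive slots (`dim U(Φ) = Σ_k d_k · (dim A_{Φ,k} V_k^H / δ_k)`, families
`dim U(Σ) = Σ_k d_k · (dim Σ_i A_{i,k} V_k^{H_i} / δ_k)`) are in the sequel F6 `CorCM/IrreducibleOddWeightsMultiplicityCMFields`
(which combines this file with F4 `CorCM/IrreducibleOddWeightsMultiplicityFamilies`).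

## References

* [Mai1989] L. Mai, *Lower bounds for the ranks of CM types*, J. Number Theory 32 (1989), §2 Prop. 1 (proof).
* [Serre1977] J.-P. Serre, *Linear Representations of Finite Groups*, GTM 42 (1977), §3.3 (induced representations,
  Frobenius reciprocity), §2.2 Prop. 4.
* [Kubota1965] T. Kubota, *On the field extension by complex multiplication*, Trans. AMS 118 (1965), Lemma 2.
* [Deligne1982HodgeCycles] P. Deligne, *Hodge cycles on abelian varieties*, LNM 900 (1982), I Ex. 3.7 (c).
-/

set_option autoImplicit false

noncomputable section

open scoped BigOperators

universe u u' v w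

namespace Summit.HodgeConjecture.CorCM.IrrOdd

open Literature.NumberTheory.ComplexMultiplication

variable {G : Type w} [Group G]

/-- The orbit span `𝒪[G, w] = span_ℚ {x ↦ w (g • x) : g ∈ G}` (local notation, no definition). -/
local notation3 (prettyPrint := false) "𝒪[" G' ", " w "]" =>
  Submodule.span ℚ (Set.range fun g : G' => fun x => w (g • x))

/-- The evaluation space `Ev[G, π, w] = {T w : T equivariant}` (local notation, no definition). -/
local notation3 (prettyPrint := false) "Ev[" G' ", " π ", " w "]" =>
  Submodule.span ℚ {v | ∃ T : (_ → ℚ) →ₗ[ℚ] _,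
    (∀ (g : G') (f : _ → ℚ), T (fun x => f (g⁻¹ • x)) = π g (T f)) ∧ T w = v}

variable {X : Type v} [MulAction G X] [DecidableEq X] {V : Type*} [AddCommGroup V] [Module ℚ V]

/-! ### §1 Equivariant maps out of `ℚ^X` and `H`-invariant vectors -/

section Frobenius

/-- `g · δ_{x₀} = δ_{g x₀}` in `ℚ^X` (`(g·f)(x) = f(g⁻¹x)`). [cite: Serre1977, §3.3] -/
theorem comp_smul_single (x₀ : X) (g : G) :
    (fun x => (Pi.single x₀ (1 : ℚ) : X → ℚ) (g⁻¹ • x)) = Pi.single (g • x₀) (1 : ℚ) := by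
  funext x
  by_cases hx : x = g • x₀
  · subst hx
    simp
  · have hx' : g⁻¹ • x ≠ x₀ := fun h => hx (by rw [← h, smul_inv_smul])
    rw [Pi.single_eq_of_ne hx', Pi.single_eq_of_ne hx]

/-- An equivariant `T : ℚ^X → V` has `T(δ_{g x₀}) = π(g) T(δ_{x₀})`. [cite: Serre1977, §3.3] -/
theorem apply_single_smul_eq (π : Representation ℚ G V) (T : (X → ℚ) →ₗ[ℚ] V)
    (hT : ∀ (g : G) (f : X → ℚ), T (fun x => f (g⁻¹ • x)) = π g (T f)) (x₀ : X) (g : G) :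
    T (Pi.single (g • x₀) (1 : ℚ)) = π g (T (Pi.single x₀ (1 : ℚ))) := by
  rw [← comp_smul_single x₀ g, hT]

/-- **`T(δ_{x₀})` is `Stab(x₀)`-invariant** for an equivariant `T : ℚ^X → V`. [cite: Serre1977, §3.3] -/
theorem apply_single_mem_invariants (π : Representation ℚ G V) (T : (X → ℚ) →ₗ[ℚ] V)
    (hT : ∀ (g : G) (f : X → ℚ), T (fun x => f (g⁻¹ • x)) = π g (T f)) (x₀ : X) :
    T (Pi.single x₀ (1 : ℚ)) ∈ Representation.invariants (π.comp (MulAction.stabilizer G x₀).subtype) := by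
  rw [Representation.mem_invariants]
  intro h
  have h1 := apply_single_smul_eq π T hT x₀ (h : G)
  rw [MulAction.mem_stabilizer_iff.1 h.2] at h1
  exact h1.symm

variable [Fintype X]

/-- **An equivariant `T : ℚ^X → V` is `T(f) = Σ_x f(x) π(s x) T(δ_{x₀})`** for any section `s` of the orbit map
(`s(x)·x₀ = x`). [cite: Serre1977, §3.3] -/
theorem apply_eq_sum_smul (π : Representation ℚ G V) (T : (X → ℚ) →ₗ[ℚ] V)
    (hT : ∀ (g : G) (f : X → ℚ), T (fun x => f (g⁻¹ • x)) = π g (T f)) {x₀ : X} {s : X → G}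
    (hs : ∀ x, s x • x₀ = x) (f : X → ℚ) :
    T f = ∑ x, f x • π (s x) (T (Pi.single x₀ (1 : ℚ))) := by
  rw [LinearMap.pi_apply_eq_sum_univ T f]
  refine Finset.sum_congr rfl fun x _ => ?_
  rw [← apply_single_smul_eq π T hT x₀ (s x), hs x]
  congr 2
  funext y
  rw [Pi.single_apply]
  exact if_congr eq_comm rfl rfl

omit [DecidableEq X] in
/-- **Conversely, every `H`-invariant `v` defines the equivariant `T_v(f) = Σ_x f(x) π(s x) v`** (well defined on
`V^H`: `π(s(gy)) v = π(g) π(s y) v` because `(s y)⁻¹ g⁻¹ s(gy) ∈ H`). [cite: Serre1977, §3.3] -/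
theorem equivariant_sum_smul (π : Representation ℚ G V) {x₀ : X} {s : X → G} (hs : ∀ x, s x • x₀ = x)
    {v : V} (hv : v ∈ Representation.invariants (π.comp (MulAction.stabilizer G x₀).subtype)) (g : G) (f : X → ℚ) :
    (∑ x, (LinearMap.proj x : (X → ℚ) →ₗ[ℚ] ℚ).smulRight (π (s x) v)) (fun x => f (g⁻¹ • x)) =
      π g ((∑ x, (LinearMap.proj x : (X → ℚ) →ₗ[ℚ] ℚ).smulRight (π (s x) v)) f) := by
  rw [Representation.mem_invariants] at hv
  simp only [LinearMap.sum_apply, LinearMap.smulRight_apply, LinearMap.proj_apply, map_sum, map_smul]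
  -- reindex `x = g • y`
  rw [← Fintype.sum_equiv (MulAction.toPerm g) _ _ (fun y => rfl)]
  refine Finset.sum_congr rfl fun y _ => ?_
  simp only [MulAction.toPerm_apply, inv_smul_smul]
  congr 1
  -- `π (s (g • y)) v = π g (π (s y) v)`
  have hmem : (s y)⁻¹ * g⁻¹ * s (g • y) ∈ MulAction.stabilizer G x₀ := by
    rw [MulAction.mem_stabilizer_iff, mul_smul, mul_smul, hs, inv_smul_smul, inv_smul_eq_iff, hs]
  have hfix := hv ⟨_, hmem⟩
  change π ((s y)⁻¹ * g⁻¹ * s (g • y)) v = v at hfix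
  have hprod : s (g • y) = g * s y * ((s y)⁻¹ * g⁻¹ * s (g • y)) := by group
  rw [hprod, map_mul, map_mul, Module.End.mul_apply, Module.End.mul_apply, hfix]

omit [MulAction G X] [DecidableEq X] in
/-- The map `T_v` evaluates at `w` to `A_w v = Σ_x w(x) π(s x) v`. [cite: Serre1977, §3.3] -/
theorem sum_smulRight_apply (π : Representation ℚ G V) (s : X → G) (v : V) (w : X → ℚ) :
    (∑ x, (LinearMap.proj x : (X → ℚ) →ₗ[ℚ] ℚ).smulRight (π (s x) v)) w = (∑ x, w x • π (s x)) v := by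
  simp only [LinearMap.sum_apply, LinearMap.smulRight_apply, LinearMap.proj_apply, LinearMap.smul_apply]

end Frobenius

/-! ### §2 The evaluation space is the image of the `H`-invariants under `A_w = Σ_x w(x) π(s x)` -/

section EvalSpace

variable [Fintype X]

/-- **`Ev[G, π, w] = A_w(V^H)`**, `A_w = Σ_x w(x) π(s x)`, `V^H` the `Stab(x₀)`-invariants, for any section `s`
of a transitive `G`-set `X ∋ x₀` and any representation `(π, V)` (Frobenius reciprocity `Hom_G(ℚ^X, V) ≅ V^H`,
`T ↦ T(δ_{x₀})`, followed by evaluation at `w`). [cite: Serre1977, §3.3] [cite: Mai1989, §2 Prop. 1 (proof)] -/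
theorem evalSpace_eq_map_invariants (π : Representation ℚ G V) {x₀ : X} {s : X → G} (hs : ∀ x, s x • x₀ = x)
    (w : X → ℚ) :
    Ev[G, π, w] = (Representation.invariants (π.comp (MulAction.stabilizer G x₀).subtype)).map (∑ x, w x • π (s x)) := by
  apply le_antisymm
  · rw [evalSpace_le_iff]
    intro T hT
    refine ⟨T (Pi.single x₀ (1 : ℚ)), apply_single_mem_invariants π T hT x₀, ?_⟩
    rw [apply_eq_sum_smul π T hT hs w, LinearMap.sum_apply]
    refine Finset.sum_congr rfl fun x _ => ?_
    rw [LinearMap.smul_apply]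
  · rintro _ ⟨v, hv, rfl⟩
    refine Submodule.subset_span ⟨∑ x, (LinearMap.proj x : (X → ℚ) →ₗ[ℚ] ℚ).smulRight (π (s x) v),
      equivariant_sum_smul π hs hv, ?_⟩
    rw [sum_smulRight_apply]

/-- `dim Ev[G, π, w] = dim A_w(V^H)` (the rank of `A_w` on the `H`-invariants). [cite: Mai1989, §2 Prop. 1 (proof)] -/
theorem finrank_evalSpace_eq_finrank_map (π : Representation ℚ G V) {x₀ : X} {s : X → G}
    (hs : ∀ x, s x • x₀ = x) (w : X → ℚ) :
    Module.finrank ℚ Ev[G, π, w] =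
      Module.finrank ℚ ((Representation.invariants (π.comp (MulAction.stabilizer G x₀).subtype)).map (∑ x, w x • π (s x))) := by
  rw [evalSpace_eq_map_invariants π hs w]

/-- **The regular case `X = G`** (`K` Galois, `G = Gal(K/ℚ)` acting on `Hom(K, ℂ) ≅ G` by left translation):
`Ev[G, π, w] = range(Σ_g w(g) π(g))` — the column space of Mai's matrix `π(w)`. [cite: Mai1989, §2 Prop. 1 (proof)] -/
theorem evalSpace_eq_range_of_regular [Fintype G] [DecidableEq G] (π : Representation ℚ G V) (w : G → ℚ) :
    Submodule.span ℚ {v | ∃ T : (G → ℚ) →ₗ[ℚ] V,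
        (∀ (g : G) (f : G → ℚ), T (fun x => f (g⁻¹ • x)) = π g (T f)) ∧ T w = v} =
      LinearMap.range (∑ g, w g • π g) := by
  have hs : ∀ x : G, x • (1 : G) = x := fun x => by rw [smul_eq_mul, mul_one]
  rw [evalSpace_eq_map_invariants π hs w]
  have hinv : Representation.invariants (π.comp (MulAction.stabilizer G (1 : G)).subtype) = ⊤ := by
    rw [eq_top_iff]
    intro v _
    rw [Representation.mem_invariants]
    rintro ⟨h, hh⟩
    rw [MulAction.mem_stabilizer_iff, smul_eq_mul, mul_one] at hh
    subst hh
    change π 1 v = v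
    rw [map_one, Module.End.one_apply]
  rw [hinv, Submodule.map_top]

end EvalSpace

end Summit.HodgeConjecture.CorCM.IrrOdd

end
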